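import Literature.AlgebraicGeometry.Motives.HodgeThetaSubalgebraUnitaryProjections
import HarnessLib

/-!
# The constant Levi profile `(4, 6)` at a raising operator of minimal rank `10` is impossible (last `p = 37` cell
# `(15 | 22)` of Ribet 1983 Thm. 3, Lie step): an orthogonal-chain dimension count

Family `hodge`, layer `Literature/AlgebraicGeometry/Motives` (pure linear algebra over `ℂ`; no geometry). Research
context: cell `pub-hodge-ring2` (HONEST FRAMING: research route conditional on HC_CM; not a corollary; Q11.4-sentence-2
already refuted in dim ≥ 3), Literature lane gen 88 — steps 5–6 of the gen-87 proof plan for the `(15 | 22)` cell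
(`HodgeThetaSubalgebraUnitaryFifteenTwentyTwoReduction`; steps 1–5a are `…InvertiblePencil`, `…SlotIdentity`,
`…ScalarOnRange`, `…WeightRelations`, `…Projections`), carried out by a SHORTER route than the joint-eigenspace /
binomial count planned there. UNCONDITIONAL; theorems only, no definition, no named fact (D-0026), no `sorry`.

THE PRINT. K. A. Ribet, Amer. J. Math. 105 (1983), Thm. 3 = Gordon's survey Thm. 6.3 (3) [held
`paper:arxiv-alg-geom_9709030` p. 18]; the Lie-algebra mechanism (root strings of an `𝔰𝔩₂`-triple, weights of a
torus) is Goodman–Wallach §2.3.1, §4.1.1; adjoints and projections are Hoffman–Kunze §8.5, §6.7.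

THE SETTING (`UnitaryProfileFourSix.false_of_profile`). `𝔊 ⊆ End(W)` bracket-closed, `Θ` an involution (`P`, `Q`),
Hermitian data `s`, `𝔊` adjoint-closed; `B ∈ 𝔊` raising of rank `10`, of MINIMAL non-zero rank, with its involution
`ι` and pieces `P ∩ U⁺` (dim `5`), `Q ∩ U⁺` (dim `10`), `B(W)`, `Q ∩ ker B` (dim `12`); HYPOTHESIS: every non-zero
raising `X ∈ 𝔊` commuting with `ι` has profile `(dim X(U⁺), dim X(U⁻)) = (4, 6)`; and (irreducibility of the Levi
algebra `L⁻`, supplied by the caller) no non-zero vector of `Q ∩ ker B` is killed by all such `X`. CONCLUSION: `False`.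

THE ARGUMENT (new; replaces the joint-eigenspace count of the gen-87 plan). Write `𝔷` for the raising elements of `𝔊`
commuting with `ι`, `X† ∈ 𝔊` for adjoints, `λ(X, Y)` for the slot constant `Y X† B + B X† Y = λ(X, Y) B`
(`UnitaryLeviSetup.slot_identity`). For `X ≠ 0`: `λ_X = λ(X, X) ≠ 0`, `X X† X = λ_X X` (`scalar_on_range`,
`op_scalar`); `λ(X, Y) = 0 ⟹ λ(Y, X) = 0` (adjoints); and for an ORTHOGONAL pair (`λ(X, Y) = 0`):
(II) `X X† Y + Y X† X = λ_X Y` (`weight_one_of`) and its adjoint (II)† `Y† X X† + X† X Y† = λ_X Y†`. Consequences: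
(a) `Y(ker X ∩ U⁻ ∩ Q) ⊆ X(U⁻)`; (b) for `p ∈ X(W)`: `X(Y† p) = 0`; (c) `B` maps `ker X ∩ Q ∩ U⁺` onto `X(U⁻)`
(`scalar_on_range`). Now take orthogonal `X₁, …, X_t ∈ 𝔷 ∖ 0` and put `N_t = Q ∩ U⁺ ∩ ⋂ ker X_a` (`n₀ = 10`),
`H_t = P ∩ U⁺ ∩ ⋂ X_a(U⁺)` (`h₀ = 5`; each `X_a(U⁺)` is a hyperplane of `P ∩ U⁺`, so `h_t ≥ 5 − t`),
`K_t = Q ∩ ker B ∩ ⋂ ker X_a` (`m₀ = 12`). By (b), `X_t` maps `N_{t−1}` ONTO a space containing `H_t`, with kernel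
`N_t`: `n_t ≤ n_{t−1} − h_t`, so `n_t ≤ 10, 6, 3, 1, 0, 0, …`. By (a), `X_t(K_{t−1}) ⊆ ⋂_{a ≤ t} X_a(U⁻)`, which by
(c) and injectivity of `B` on `Q ∩ U⁺` has dimension `≤ n_t`: `m_t ≥ m_{t−1} − n_t ≥ 12 − 10 = 2`. A maximal
orthogonal family spans `𝔷` modulo elements orthogonal to it, which vanish (`λ_Y ≠ 0`), so `K_t` is killed by all of
`𝔷` — contradicting the irreducibility input. (REMARK, not used: the data are those of `𝔰𝔩₇` on `Λ⁴ℂ⁷ ⊕ ℂ²`,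
`dim Λ⁴ℂ⁷ = 35 = 37 − 2`; the `2` is the forced joint kernel.)
[cite: Ribet1983, Thm. 3] [cite: Gordon1997, Thm. 6.3 (3)] [cite: GoodmanWallachGTM255, §2.3.1, §4.1.1]
[cite: HoffmanKunze1971LinearAlgebra, §8.5, §6.7, §3.1 Thm. 2] [cite: Deligne1982HodgeCycles, I §3 Prop. 3.4, 3.6]

## References
* [Ribet1983] K. A. Ribet, *Hodge classes on certain types of abelian varieties*, Amer. J. Math. 105 (1983), Thm. 3.
* [Gordon1997] B. B. Gordon, *A survey of the Hodge conjecture for abelian varieties*, Thm. 6.3 (3), pp. 18–19.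
* [GoodmanWallachGTM255] R. Goodman, N. R. Wallach, GTM 255 (2009), §2.3.1, §4.1.1.
* [HoffmanKunze1971LinearAlgebra] K. Hoffman, R. Kunze, *Linear Algebra* (1971), §3.1 Thm. 2, §6.7, §8.5.
* [Deligne1982HodgeCycles] P. Deligne, *Hodge cycles on abelian varieties*, LNM 900 (1982), I §3 Prop. 3.4, 3.6.
-/

noncomputable section

open Module

namespace Literature.AlgebraicGeometry.Motives

namespace HodgeStructure

universe u

variable {W : Type u} [AddCommGroup W] [Module ℂ W]

/-! ### §1 Small tools: rank–nullity on a subspace, infima over `Fin (t+1)`, the adjoint weight-one relation -/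

/-- Rank–nullity for the restriction of `Y` to a subspace `N`: `dim (N ∩ ker Y) + dim Y(N) = dim N`.
[cite: HoffmanKunze1971LinearAlgebra, §3.1 Thm. 2] -/
theorem UnitaryProfileFourSix.finrank_inf_ker_add_finrank_map [FiniteDimensional ℂ W] (N : Submodule ℂ W)
    (Y : Module.End ℂ W) :
    Module.finrank ℂ ↥(N ⊓ LinearMap.ker Y) + Module.finrank ℂ (N.map Y) = Module.finrank ℂ N := by
  have h := LinearMap.finrank_range_add_finrank_ker (Y.domRestrict N)
  rw [LinearMap.range_domRestrict, LinearMap.ker_domRestrict] at h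
  have h2 : Module.finrank ℂ ((LinearMap.ker Y).comap N.subtype) = Module.finrank ℂ ↥(N ⊓ LinearMap.ker Y) := by
    rw [← Submodule.finrank_map_subtype_eq N ((LinearMap.ker Y).comap N.subtype), Submodule.map_comap_subtype]
  omega

/-- `⨅` over `Fin (t+1)` of a family extended by `Fin.snoc`, composed with any map into a complete lattice.
[folklore] -/
private theorem UnitaryProfileFourSix.iInf_comp_snoc {α β : Type*} [CompleteLattice β] {t : ℕ} (f : α → β) (X : Fin t → α)
    (y : α) : (⨅ a, f ((Fin.snoc X y : Fin (t + 1) → α) a)) = (⨅ a, f (X a)) ⊓ f y := by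
  apply le_antisymm
  · refine le_inf (le_iInf fun a => ?_) ?_
    · simpa using iInf_le (fun a => f ((Fin.snoc X y : Fin (t + 1) → α) a)) a.castSucc
    · simpa using iInf_le (fun a => f ((Fin.snoc X y : Fin (t + 1) → α) a)) (Fin.last t)
  · refine le_iInf fun a => ?_
    refine Fin.lastCases ?_ (fun a => ?_) a
    · simp
    · simpa using inf_le_left.trans (iInf_le (fun a => f (X a)) a)

/-- The adjoint of the weight-one relation (II): for raising `X, Y` with adjoints `X†, Y†` and a REAL constant `c`,
`X X† Y + Y X† X = c Y` implies `Y† X X† + X† X Y† = c Y†`. [cite: HoffmanKunze1971LinearAlgebra, §8.5]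
[cite: GoodmanWallachGTM255, §2.3.1] -/
theorem UnitaryProfileFourSix.adjoint_weight_one {Θ : Module.End ℂ W} (hΘΘ : Θ * Θ = 1)
    {P Q : Submodule ℂ W} (hP : ∀ x, x ∈ P ↔ Θ x = x) (hQ : ∀ x, x ∈ Q ↔ Θ x = -x)
    {s : W → W → ℂ} (hadd : ∀ x y z, s (x + y) z = s x z + s y z)
    (hsmul : ∀ (c : ℂ) (x y : W), s (c • x) y = c * s x y) (hsymm : ∀ x y, s y x = starRingEnd ℂ (s x y))
    (hPQ : ∀ p ∈ P, ∀ q ∈ Q, s p q = 0) (hdefP : ∀ p ∈ P, s p p = 0 → p = 0) (hdefQ : ∀ q ∈ Q, s q q = 0 → q = 0)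
    {X Xa Y Ya : Module.End ℂ W} (hXXa : ∀ x y, s (X x) y = s x (Xa y)) (hYYa : ∀ x y, s (Y x) y = s x (Ya y))
    {c : ℂ} (hcreal : starRingEnd ℂ c = c) (hII : X * Xa * Y + Y * Xa * X = c • Y) :
    Ya * X * Xa + Xa * X * Ya = c • Ya := by
  obtain ⟨haddr, -, -, -, -, hsubr, -⟩ := UnitaryTwoOdd.herm_right hadd hsymm
  have hnd := fun y => UnitaryTwoOdd.eq_zero_of_forall_left hadd hsymm hΘΘ hP hQ hPQ hdefP hdefQ (y := y)
  have hXaX : ∀ x y, s (Xa x) y = s x (X y) := fun x y => by rw [hsymm, ← hXXa, ← hsymm]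
  have hsmulr : ∀ (a : ℂ) x y, s x (a • y) = starRingEnd ℂ a * s x y := fun a x y => by
    rw [hsymm, hsmul, map_mul, ← hsymm]
  refine LinearMap.ext fun y => ?_
  rw [← sub_eq_zero, ← LinearMap.sub_apply]
  refine hnd _ fun x => ?_
  rw [LinearMap.sub_apply, hsubr, LinearMap.add_apply, haddr, LinearMap.smul_apply, hsmulr, hcreal]
  simp only [Module.End.mul_apply]
  rw [← hYYa, ← hXaX, ← hXXa, ← hXXa, ← hXaX, ← hYYa, ← hadd, ← hsmul]
  have h := congrArg (fun T : Module.End ℂ W => T x) hII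
  simp only [LinearMap.add_apply, Module.End.mul_apply, LinearMap.smul_apply] at h
  rw [h, hsmul, hsmul, hYYa, sub_self]

/-- Symmetry of slot-orthogonality: if `Y X† Y = 0` (the `(X, Y)` slot constant vanishes) and `X Y† X = c' X` with
`X ≠ 0`, then `c' = 0` (the adjoint of `Y X† Y` is `Y† X Y†`). [cite: HoffmanKunze1971LinearAlgebra, §8.5] -/
theorem UnitaryProfileFourSix.slot_symm_zero {Θ : Module.End ℂ W} (hΘΘ : Θ * Θ = 1)
    {P Q : Submodule ℂ W} (hP : ∀ x, x ∈ P ↔ Θ x = x) (hQ : ∀ x, x ∈ Q ↔ Θ x = -x)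
    {s : W → W → ℂ} (hadd : ∀ x y z, s (x + y) z = s x z + s y z)
    (hsymm : ∀ x y, s y x = starRingEnd ℂ (s x y))
    (hPQ : ∀ p ∈ P, ∀ q ∈ Q, s p q = 0) (hdefP : ∀ p ∈ P, s p p = 0 → p = 0) (hdefQ : ∀ q ∈ Q, s q q = 0 → q = 0)
    {X Xa Y Ya : Module.End ℂ W} (hXXa : ∀ x y, s (X x) y = s x (Xa y)) (hYYa : ∀ x y, s (Y x) y = s x (Ya y))
    (hYXY : Y * Xa * Y = 0) {c' : ℂ} (hXYX : X * Ya * X = c' • X) (hX0 : X ≠ 0) : c' = 0 := by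
  obtain ⟨-, -, h0l, -, -, -, -⟩ := UnitaryTwoOdd.herm_right hadd hsymm
  have hnd := fun y => UnitaryTwoOdd.eq_zero_of_forall_left hadd hsymm hΘΘ hP hQ hPQ hdefP hdefQ (y := y)
  have hXaX : ∀ x y, s (Xa x) y = s x (X y) := fun x y => by rw [hsymm, ← hXXa, ← hsymm]
  -- the adjoint `Y† X Y†` of `Y X† Y` vanishes
  have hadj0 : Ya * X * Ya = 0 := by
    refine LinearMap.ext fun y => ?_
    rw [LinearMap.zero_apply]
    refine hnd _ fun x => ?_
    rw [Module.End.mul_apply, Module.End.mul_apply, ← hYYa, ← hXaX, ← hYYa]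
    have h := congrArg (fun T : Module.End ℂ W => T x) hYXY
    simp only [Module.End.mul_apply, LinearMap.zero_apply] at h
    rw [h, h0l]
  by_contra hc'
  -- `X Y† X Y† = c' X Y†` and `= X (Y† X Y†) = 0`
  have h1 : c' • (X * Ya) = 0 := by
    rw [← smul_mul_assoc, ← hXYX, mul_assoc, mul_assoc, ← mul_assoc Ya X Ya, hadj0, mul_zero]
  have hXYa : X * Ya = 0 := (smul_eq_zero.1 h1).resolve_left hc'
  have h2 : c' • X = 0 := by rw [← hXYX, hXYa, zero_mul]
  exact hX0 ((smul_eq_zero.1 h2).resolve_left hc')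


/-! ### §2 One member of `𝔷`: the slot constant `λ_X`, the scaled partial isometry, and `B : ker X ∩ Q ∩ U⁺ ↠ X(U⁻)` -/

/-- **Member package.** At a raising `B ∈ 𝔊` of minimal rank with Levi data, for a non-zero raising `X ∈ 𝔊` commuting
with `ι` of profile `(i, j)`, `i + j = rk B`, `i < j`, with adjoint `X† ∈ 𝔊`: the slot constant `λ = λ(X, X)` is
non-zero and real, `X X† B + B X† X = λ B`, `X X† X = λ X`, `X X† = λ` on `X(U⁺)` and on `X(U⁻)`, and every vector
of `X(U⁻)` is `B q` for some `q ∈ Q ∩ U⁺` with `X q = 0`. [cite: GoodmanWallachGTM255, §2.3.1, §4.1.1]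
[cite: HoffmanKunze1971LinearAlgebra, §8.5, §3.1 Thm. 2] [cite: Deligne1982HodgeCycles, I §3 Prop. 3.4, 3.6] -/
theorem UnitaryProfileFourSix.member [FiniteDimensional ℂ W] {𝔊 : Submodule ℂ (Module.End ℂ W)}
    (hbr : ∀ Y ∈ 𝔊, ∀ Z ∈ 𝔊, Y * Z - Z * Y ∈ 𝔊) {Θ : Module.End ℂ W} (hΘΘ : Θ * Θ = 1)
    {P Q : Submodule ℂ W} (hP : ∀ x, x ∈ P ↔ Θ x = x) (hQ : ∀ x, x ∈ Q ↔ Θ x = -x)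
    {s : W → W → ℂ} (hadd : ∀ x y z, s (x + y) z = s x z + s y z)
    (hsmul : ∀ (c : ℂ) (x y : W), s (c • x) y = c * s x y) (hsymm : ∀ x y, s y x = starRingEnd ℂ (s x y))
    (hPQ : ∀ p ∈ P, ∀ q ∈ Q, s p q = 0) (hdefP : ∀ p ∈ P, s p p = 0 → p = 0) (hdefQ : ∀ q ∈ Q, s q q = 0 → q = 0)
    (hadj : ∀ X ∈ 𝔊, ∃ Y ∈ 𝔊, ∀ x y, s (X x) y = s x (Y y))
    {B : Module.End ℂ W} (hΘB : Θ * B = B) (hBΘ : B * Θ = -B) (hB0 : B ≠ 0)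
    (hmin : ∀ Z ∈ 𝔊, Θ * Z = Z → Z * Θ = -Z → Z ≠ 0 →
      Module.finrank ℂ (LinearMap.range B) ≤ Module.finrank ℂ (LinearMap.range Z))
    {C : Module.End ℂ W} (hC : C ∈ 𝔊) (hBC : ∀ x y, s (B x) y = s x (C y))
    {ι : Module.End ℂ W} {Um Up QU : Submodule ℂ W} (hιι : ι * ι = 1) (hιΘ : ι * Θ = Θ * ι)
    (hιs : ∀ x y, s (ι x) y = s x (ι y)) (hUm : ∀ x, x ∈ Um ↔ ι x = -x) (hUp : ∀ x, x ∈ Up ↔ ι x = x)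
    (hPM : ∀ x, x ∈ LinearMap.range B ↔ ι x = -x ∧ Θ x = x)
    (hQM : ∀ x, x ∈ Q ⊓ LinearMap.ker B ↔ ι x = -x ∧ Θ x = -x) (hQU : ∀ x, x ∈ QU ↔ ι x = x ∧ Θ x = -x)
    (hfinQU : Module.finrank ℂ QU = Module.finrank ℂ (LinearMap.range B))
    {X Xa : Module.End ℂ W} (hX : X ∈ 𝔊) (hΘX : Θ * X = X) (hXΘ : X * Θ = -X) (hXc : X * ι = ι * X) (hX0 : X ≠ 0)
    (hXa : Xa ∈ 𝔊) (hXXa : ∀ x y, s (X x) y = s x (Xa y))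
    (hsum : Module.finrank ℂ (Up.map X) + Module.finrank ℂ (Um.map X) = Module.finrank ℂ (LinearMap.range B))
    (hij : Module.finrank ℂ (Up.map X) < Module.finrank ℂ (Um.map X)) :
    ∃ μ : ℂ, μ ≠ 0 ∧ starRingEnd ℂ μ = μ ∧ X * Xa * B + B * Xa * X = μ • B ∧ X * Xa * X = μ • X ∧
      (∀ p ∈ Up.map X, X (Xa p) = μ • p) ∧ (∀ p ∈ Um.map X, X (Xa p) = μ • p) ∧
      (∀ p ∈ Um.map X, ∃ q ∈ QU, X q = 0 ∧ B q = p) := by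
  classical
  obtain ⟨-, h0r, -, -, -, -, -⟩ := UnitaryTwoOdd.herm_right hadd hsymm
  obtain ⟨μ, hμB⟩ := UnitaryLeviSetup.slot_identity hbr hΘΘ hP hQ hadd hsymm hPQ hdefP hdefQ hadj hΘB hBΘ hB0 hmin hC
    hBC hιι hιΘ hιs hPM hQM hQU hfinQU hX hΘX hXΘ hXc hXXa hΘX hXΘ hXc hXa hXXa
  obtain ⟨hμ, hm, hp⟩ := UnitaryLeviSetup.scalar_on_range hΘΘ hP hQ hadd hsymm hPQ hdefP hdefQ hιι hιΘ hιs hUm hUp hPM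
    hQM hQU hfinQU hΘX hXΘ hXc hXXa hΘX hXΘ hXc hXXa hμB hμB hsum hij
  have hXXX : X * Xa * X = μ • X := UnitaryLeviSetup.op_scalar hιι hUm hUp hm hp
  have hreal : starRingEnd ℂ μ = μ := UnitaryLeviSetup.slotConstant_real hP hsmul hsymm hdefP hΘX hXXa hXXX hX0
  refine ⟨μ, hμ, hreal, hμB, hXXX, hp, hm, fun p hpm => ?_⟩
  -- `B : Q ∩ U⁺ → B(W)` is a bijection; `X(U⁻) ⊆ B(W)`
  obtain ⟨hΘXa, -, hXac, -⟩ := UnitaryLeviSetup.adj_raise hΘΘ hP hQ hadd hsymm hPQ hdefP hdefQ hιs hΘX hXΘ hXc hXXa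
  have hXι : ∀ v, X (ι v) = ι (X v) := fun v => by rw [← Module.End.mul_apply, hXc, Module.End.mul_apply]
  have hXaι : ∀ v, Xa (ι v) = ι (Xa v) := fun v => by rw [← Module.End.mul_apply, hXac, Module.End.mul_apply]
  have hΘXv : ∀ w, Θ (X w) = X w := fun w => by rw [← Module.End.mul_apply, hΘX]
  have hΘXav : ∀ w, Θ (Xa w) = -(Xa w) := fun w => by rw [← Module.End.mul_apply, hΘXa, LinearMap.neg_apply]
  have hBinj : ∀ a ∈ QU, B a = 0 → a = 0 := by
    intro a ha hBa
    obtain ⟨hιa, hΘa⟩ := (hQU a).1 ha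
    have hmem : a ∈ Q ⊓ LinearMap.ker B := Submodule.mem_inf.2 ⟨(hQ a).2 hΘa, LinearMap.mem_ker.2 hBa⟩
    obtain ⟨hιa', -⟩ := (hQM a).1 hmem
    rw [hιa] at hιa'
    have h2 : (2 : ℂ) • a = 0 := by rw [two_smul]; nth_rewrite 2 [hιa']; rw [add_neg_cancel]
    exact (smul_eq_zero.1 h2).resolve_left two_ne_zero
  have hQUB : QU.map B = LinearMap.range B := by
    refine Submodule.eq_of_le_of_finrank_eq LinearMap.map_le_range ?_
    have hker := LinearMap.finrank_range_add_finrank_ker (B.domRestrict QU)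
    rw [LinearMap.range_domRestrict] at hker
    have hk0 : LinearMap.ker (B.domRestrict QU) = ⊥ := by
      refine (Submodule.eq_bot_iff _).2 fun v hv => ?_
      rw [LinearMap.mem_ker, LinearMap.domRestrict_apply] at hv
      exact Subtype.ext (hBinj _ v.2 hv)
    rw [hk0, finrank_bot, add_zero] at hker
    rw [hker, hfinQU]
  obtain ⟨u, hu, rfl⟩ := Submodule.mem_map.1 hpm
  have hXuP : X u ∈ LinearMap.range B := (hPM _).2 ⟨by rw [← hXι, (hUm u).1 hu, map_neg], hΘXv u⟩
  rw [← hQUB] at hXuP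
  obtain ⟨q, hq, hqXu⟩ := Submodule.mem_map.1 hXuP
  refine ⟨q, hq, ?_, hqXu⟩
  -- the slot identity at `q`: `X X† (B q) + B (X† X q) = μ B q`, and `X X† (B q) = μ B q`
  have h := congrArg (fun T : Module.End ℂ W => T q) hμB
  simp only [LinearMap.add_apply, Module.End.mul_apply, LinearMap.smul_apply] at h
  rw [hqXu, hm _ hpm, add_eq_left] at h
  -- `X† X q ∈ Q ∩ U⁺`, so it vanishes, so `X q` is isotropic
  obtain ⟨hιq, -⟩ := (hQU q).1 hq
  have hmemQU : Xa (X q) ∈ QU := (hQU _).2 ⟨by rw [← hXaι, ← hXι, hιq], hΘXav _⟩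
  have h0 : Xa (X q) = 0 := hBinj _ hmemQU h
  refine hdefP _ ((hP _).2 (hΘXv q)) ?_
  rw [hXXa, h0, h0r]

/-- **Orthogonal-pair package.** In the setting of `member`, let `X, Y` be non-zero raising elements of `𝔊` commuting
with `ι`, of profiles `(i, j)` with `i + j = rk B`, `i < j` (also for `X + Y`), with adjoints `X†, Y† ∈ 𝔊`, slot data
`X X† B + B X† X = λ B` (`λ ≠ 0` real, `X X† X = λ X`) and ORTHOGONAL: `Y X† B + B X† Y = 0`. Then (II)
`X X† Y + Y X† X = λ Y` and (II)† `Y† X X† + X† X Y† = λ Y†`. [cite: GoodmanWallachGTM255, §2.3.1, §4.1.1]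
[cite: HoffmanKunze1971LinearAlgebra, §8.5] [cite: Deligne1982HodgeCycles, I §3 Prop. 3.4, 3.6] -/
theorem UnitaryProfileFourSix.pair [FiniteDimensional ℂ W] {𝔊 : Submodule ℂ (Module.End ℂ W)}
    (hbr : ∀ Y ∈ 𝔊, ∀ Z ∈ 𝔊, Y * Z - Z * Y ∈ 𝔊) {Θ : Module.End ℂ W} (hΘΘ : Θ * Θ = 1)
    {P Q : Submodule ℂ W} (hP : ∀ x, x ∈ P ↔ Θ x = x) (hQ : ∀ x, x ∈ Q ↔ Θ x = -x)
    {s : W → W → ℂ} (hadd : ∀ x y z, s (x + y) z = s x z + s y z)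
    (hsmul : ∀ (c : ℂ) (x y : W), s (c • x) y = c * s x y) (hsymm : ∀ x y, s y x = starRingEnd ℂ (s x y))
    (hPQ : ∀ p ∈ P, ∀ q ∈ Q, s p q = 0) (hdefP : ∀ p ∈ P, s p p = 0 → p = 0) (hdefQ : ∀ q ∈ Q, s q q = 0 → q = 0)
    (hadj : ∀ X ∈ 𝔊, ∃ Y ∈ 𝔊, ∀ x y, s (X x) y = s x (Y y))
    {B : Module.End ℂ W} (hΘB : Θ * B = B) (hBΘ : B * Θ = -B) (hB0 : B ≠ 0)
    (hmin : ∀ Z ∈ 𝔊, Θ * Z = Z → Z * Θ = -Z → Z ≠ 0 →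
      Module.finrank ℂ (LinearMap.range B) ≤ Module.finrank ℂ (LinearMap.range Z))
    {C : Module.End ℂ W} (hC : C ∈ 𝔊) (hBC : ∀ x y, s (B x) y = s x (C y))
    {ι : Module.End ℂ W} {Um Up QU : Submodule ℂ W} (hιι : ι * ι = 1) (hιΘ : ι * Θ = Θ * ι)
    (hιs : ∀ x y, s (ι x) y = s x (ι y)) (hUm : ∀ x, x ∈ Um ↔ ι x = -x) (hUp : ∀ x, x ∈ Up ↔ ι x = x)
    (hPM : ∀ x, x ∈ LinearMap.range B ↔ ι x = -x ∧ Θ x = x)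
    (hQM : ∀ x, x ∈ Q ⊓ LinearMap.ker B ↔ ι x = -x ∧ Θ x = -x) (hQU : ∀ x, x ∈ QU ↔ ι x = x ∧ Θ x = -x)
    (hfinQU : Module.finrank ℂ QU = Module.finrank ℂ (LinearMap.range B))
    {X Xa Y Ya : Module.End ℂ W} (hX : X ∈ 𝔊) (hΘX : Θ * X = X) (hXΘ : X * Θ = -X) (hXc : X * ι = ι * X)
    (hXXa : ∀ x y, s (X x) y = s x (Xa y))
    (hY : Y ∈ 𝔊) (hΘY : Θ * Y = Y) (hYΘ : Y * Θ = -Y) (hYc : Y * ι = ι * Y) (hYa : Ya ∈ 𝔊)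
    (hYYa : ∀ x y, s (Y x) y = s x (Ya y))
    (hsumY : Module.finrank ℂ (Up.map Y) + Module.finrank ℂ (Um.map Y) = Module.finrank ℂ (LinearMap.range B))
    (hijY : Module.finrank ℂ (Up.map Y) < Module.finrank ℂ (Um.map Y))
    (hsumXY : Module.finrank ℂ (Up.map (X + Y)) + Module.finrank ℂ (Um.map (X + Y)) =
      Module.finrank ℂ (LinearMap.range B))
    (hijXY : Module.finrank ℂ (Up.map (X + Y)) < Module.finrank ℂ (Um.map (X + Y)))
    (hXa : Xa ∈ 𝔊) {μ : ℂ} (hμreal : starRingEnd ℂ μ = μ)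
    (hμB : X * Xa * B + B * Xa * X = μ • B) (hXXX : X * Xa * X = μ • X)
    (horth : Y * Xa * B + B * Xa * Y = 0) :
    X * Xa * Y + Y * Xa * X = μ • Y ∧ Ya * X * Xa + Xa * X * Ya = μ • Ya := by
  classical
  obtain ⟨haddr, -, -, -, -, -, -⟩ := UnitaryTwoOdd.herm_right hadd hsymm
  -- `Y X† Y = 0`
  obtain ⟨ν, hνB⟩ := UnitaryLeviSetup.slot_identity hbr hΘΘ hP hQ hadd hsymm hPQ hdefP hdefQ hadj hΘB hBΘ hB0 hmin hC
    hBC hιι hιΘ hιs hPM hQM hQU hfinQU hY hΘY hYΘ hYc hYYa hΘY hYΘ hYc hYa hYYa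
  have horth' : Y * Xa * B + B * Xa * Y = (0 : ℂ) • B := by rw [horth, zero_smul]
  obtain ⟨-, hm0, hp0⟩ := UnitaryLeviSetup.scalar_on_range hΘΘ hP hQ hadd hsymm hPQ hdefP hdefQ hιι hιΘ hιs hUm hUp hPM
    hQM hQU hfinQU hΘY hYΘ hYc hYYa hΘX hXΘ hXc hXXa hνB horth' hsumY hijY
  have hYXY : Y * Xa * Y = 0 := by
    rw [UnitaryLeviSetup.op_scalar hιι hUm hUp hm0 hp0, zero_smul]
  -- `(X + Y) X† (X + Y) = μ (X + Y)`
  have hΘS : Θ * (X + Y) = X + Y := by rw [mul_add, hΘX, hΘY]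
  have hSΘ : (X + Y) * Θ = -(X + Y) := by rw [add_mul, hXΘ, hYΘ, neg_add]
  have hSc : (X + Y) * ι = ι * (X + Y) := by rw [add_mul, mul_add, hXc, hYc]
  have hSa : Xa + Ya ∈ 𝔊 := Submodule.add_mem _ hXa hYa
  have hSSa : ∀ x y, s ((X + Y) x) y = s x ((Xa + Ya) y) := fun x y => by
    rw [LinearMap.add_apply, LinearMap.add_apply, hadd, haddr, hXXa, hYYa]
  obtain ⟨ρ, hρB⟩ := UnitaryLeviSetup.slot_identity hbr hΘΘ hP hQ hadd hsymm hPQ hdefP hdefQ hadj hΘB hBΘ hB0 hmin hC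
    hBC hιι hιΘ hιs hPM hQM hQU hfinQU (Submodule.add_mem _ hX hY) hΘS hSΘ hSc hSSa hΘS hSΘ hSc hSa hSSa
  have hXS : (X + Y) * Xa * B + B * Xa * (X + Y) = μ • B := by
    have : (X + Y) * Xa * B + B * Xa * (X + Y) = (X * Xa * B + B * Xa * X) + (Y * Xa * B + B * Xa * Y) := by
      simp only [add_mul, mul_add]; abel
    rw [this, hμB, horth, add_zero]
  obtain ⟨-, hmS, hpS⟩ := UnitaryLeviSetup.scalar_on_range hΘΘ hP hQ hadd hsymm hPQ hdefP hdefQ hιι hιΘ hιs hUm hUp hPM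
    hQM hQU hfinQU hΘS hSΘ hSc hSSa hΘX hXΘ hXc hXXa hρB hXS hsumXY hijXY
  have hSXS : (X + Y) * Xa * (X + Y) = μ • (X + Y) := UnitaryLeviSetup.op_scalar hιι hUm hUp hmS hpS
  have hII : X * Xa * Y + Y * Xa * X = μ • Y := UnitaryLeviSetup.weight_one_of hXXX hYXY hSXS
  exact ⟨hII, UnitaryProfileFourSix.adjoint_weight_one hΘΘ hP hQ hadd hsmul hsymm hPQ hdefP hdefQ hXXa hYYa hμreal hII⟩


/-- **Symmetry of orthogonality.** In the setting of `member`, for non-zero raising `X, Y ∈ 𝔊` commuting with `ι` (profiles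
`(i, j)`, `i + j = rk B`, `i < j`) with adjoints in `𝔊`: `Y X† B + B X† Y = 0 ⟹ X Y† B + B Y† X = 0`.
[cite: HoffmanKunze1971LinearAlgebra, §8.5] [cite: GoodmanWallachGTM255, §4.1.1] -/
theorem UnitaryProfileFourSix.orth_symm [FiniteDimensional ℂ W] {𝔊 : Submodule ℂ (Module.End ℂ W)}
    (hbr : ∀ Y ∈ 𝔊, ∀ Z ∈ 𝔊, Y * Z - Z * Y ∈ 𝔊) {Θ : Module.End ℂ W} (hΘΘ : Θ * Θ = 1)
    {P Q : Submodule ℂ W} (hP : ∀ x, x ∈ P ↔ Θ x = x) (hQ : ∀ x, x ∈ Q ↔ Θ x = -x)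
    {s : W → W → ℂ} (hadd : ∀ x y z, s (x + y) z = s x z + s y z)
    (hsymm : ∀ x y, s y x = starRingEnd ℂ (s x y))
    (hPQ : ∀ p ∈ P, ∀ q ∈ Q, s p q = 0) (hdefP : ∀ p ∈ P, s p p = 0 → p = 0) (hdefQ : ∀ q ∈ Q, s q q = 0 → q = 0)
    (hadj : ∀ X ∈ 𝔊, ∃ Y ∈ 𝔊, ∀ x y, s (X x) y = s x (Y y))
    {B : Module.End ℂ W} (hΘB : Θ * B = B) (hBΘ : B * Θ = -B) (hB0 : B ≠ 0)
    (hmin : ∀ Z ∈ 𝔊, Θ * Z = Z → Z * Θ = -Z → Z ≠ 0 →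
      Module.finrank ℂ (LinearMap.range B) ≤ Module.finrank ℂ (LinearMap.range Z))
    {C : Module.End ℂ W} (hC : C ∈ 𝔊) (hBC : ∀ x y, s (B x) y = s x (C y))
    {ι : Module.End ℂ W} {Um Up QU : Submodule ℂ W} (hιι : ι * ι = 1) (hιΘ : ι * Θ = Θ * ι)
    (hιs : ∀ x y, s (ι x) y = s x (ι y)) (hUm : ∀ x, x ∈ Um ↔ ι x = -x) (hUp : ∀ x, x ∈ Up ↔ ι x = x)
    (hPM : ∀ x, x ∈ LinearMap.range B ↔ ι x = -x ∧ Θ x = x)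
    (hQM : ∀ x, x ∈ Q ⊓ LinearMap.ker B ↔ ι x = -x ∧ Θ x = -x) (hQU : ∀ x, x ∈ QU ↔ ι x = x ∧ Θ x = -x)
    (hfinQU : Module.finrank ℂ QU = Module.finrank ℂ (LinearMap.range B))
    {X Xa Y Ya : Module.End ℂ W} (hX : X ∈ 𝔊) (hΘX : Θ * X = X) (hXΘ : X * Θ = -X) (hXc : X * ι = ι * X)
    (hX0 : X ≠ 0) (hXa : Xa ∈ 𝔊) (hXXa : ∀ x y, s (X x) y = s x (Xa y))
    (hY : Y ∈ 𝔊) (hΘY : Θ * Y = Y) (hYΘ : Y * Θ = -Y) (hYc : Y * ι = ι * Y) (hYa : Ya ∈ 𝔊)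
    (hYYa : ∀ x y, s (Y x) y = s x (Ya y))
    (hsumX : Module.finrank ℂ (Up.map X) + Module.finrank ℂ (Um.map X) = Module.finrank ℂ (LinearMap.range B))
    (hijX : Module.finrank ℂ (Up.map X) < Module.finrank ℂ (Um.map X))
    (hsumY : Module.finrank ℂ (Up.map Y) + Module.finrank ℂ (Um.map Y) = Module.finrank ℂ (LinearMap.range B))
    (hijY : Module.finrank ℂ (Up.map Y) < Module.finrank ℂ (Um.map Y))
    (horth : Y * Xa * B + B * Xa * Y = 0) : X * Ya * B + B * Ya * X = 0 := by
  classical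
  -- `Y X† Y = 0`
  obtain ⟨ν, hνB⟩ := UnitaryLeviSetup.slot_identity hbr hΘΘ hP hQ hadd hsymm hPQ hdefP hdefQ hadj hΘB hBΘ hB0 hmin hC
    hBC hιι hιΘ hιs hPM hQM hQU hfinQU hY hΘY hYΘ hYc hYYa hΘY hYΘ hYc hYa hYYa
  have horth' : Y * Xa * B + B * Xa * Y = (0 : ℂ) • B := by rw [horth, zero_smul]
  obtain ⟨-, hm0, hp0⟩ := UnitaryLeviSetup.scalar_on_range hΘΘ hP hQ hadd hsymm hPQ hdefP hdefQ hιι hιΘ hιs hUm hUp hPM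
    hQM hQU hfinQU hΘY hYΘ hYc hYYa hΘX hXΘ hXc hXXa hνB horth' hsumY hijY
  have hYXY : Y * Xa * Y = 0 := by
    rw [UnitaryLeviSetup.op_scalar hιι hUm hUp hm0 hp0, zero_smul]
  -- `X Y† X = c' X`
  obtain ⟨μ, hμB⟩ := UnitaryLeviSetup.slot_identity hbr hΘΘ hP hQ hadd hsymm hPQ hdefP hdefQ hadj hΘB hBΘ hB0 hmin hC
    hBC hιι hιΘ hιs hPM hQM hQU hfinQU hX hΘX hXΘ hXc hXXa hΘX hXΘ hXc hXa hXXa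
  obtain ⟨c', hc'B⟩ := UnitaryLeviSetup.slot_identity hbr hΘΘ hP hQ hadd hsymm hPQ hdefP hdefQ hadj hΘB hBΘ hB0 hmin hC
    hBC hιι hιΘ hιs hPM hQM hQU hfinQU hY hΘY hYΘ hYc hYYa hΘX hXΘ hXc hXa hXXa
  obtain ⟨-, hm1, hp1⟩ := UnitaryLeviSetup.scalar_on_range hΘΘ hP hQ hadd hsymm hPQ hdefP hdefQ hιι hιΘ hιs hUm hUp hPM
    hQM hQU hfinQU hΘX hXΘ hXc hXXa hΘY hYΘ hYc hYYa hμB hc'B hsumX hijX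
  have hXYX : X * Ya * X = c' • X := UnitaryLeviSetup.op_scalar hιι hUm hUp hm1 hp1
  have hc' : c' = 0 :=
    UnitaryProfileFourSix.slot_symm_zero hΘΘ hP hQ hadd hsymm hPQ hdefP hdefQ hXXa hYYa hYXY hXYX hX0
  rw [hc'B, hc', zero_smul]

/-! ### §3 The theorem: the constant profile `(4, 6)` is impossible -/

/-- **The constant Levi profile `(4, 6)` at a minimal raising operator of rank `10` (pieces of dimensions `5, 10, 10, 12`)
is impossible.** See the module docstring for the statement and the orthogonal-chain argument.
[cite: Ribet1983, Thm. 3] [cite: Gordon1997, Thm. 6.3 (3)] [cite: GoodmanWallachGTM255, §2.3.1, §4.1.1]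
[cite: HoffmanKunze1971LinearAlgebra, §8.5, §3.1 Thm. 2] [cite: Deligne1982HodgeCycles, I §3 Prop. 3.4, 3.6] -/
theorem UnitaryProfileFourSix.false_of_profile [FiniteDimensional ℂ W] {𝔊 : Submodule ℂ (Module.End ℂ W)}
    (hbr : ∀ Y ∈ 𝔊, ∀ Z ∈ 𝔊, Y * Z - Z * Y ∈ 𝔊) {Θ : Module.End ℂ W} (hΘΘ : Θ * Θ = 1)
    {P Q : Submodule ℂ W} (hP : ∀ x, x ∈ P ↔ Θ x = x) (hQ : ∀ x, x ∈ Q ↔ Θ x = -x)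
    {s : W → W → ℂ} (hadd : ∀ x y z, s (x + y) z = s x z + s y z)
    (hsmul : ∀ (c : ℂ) (x y : W), s (c • x) y = c * s x y) (hsymm : ∀ x y, s y x = starRingEnd ℂ (s x y))
    (hPQ : ∀ p ∈ P, ∀ q ∈ Q, s p q = 0) (hdefP : ∀ p ∈ P, s p p = 0 → p = 0) (hdefQ : ∀ q ∈ Q, s q q = 0 → q = 0)
    (hadj : ∀ X ∈ 𝔊, ∃ Y ∈ 𝔊, ∀ x y, s (X x) y = s x (Y y))
    {B : Module.End ℂ W} (hB : B ∈ 𝔊) (hΘB : Θ * B = B) (hBΘ : B * Θ = -B)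
    (hr : Module.finrank ℂ (LinearMap.range B) = 10)
    (hmin : ∀ Z ∈ 𝔊, Θ * Z = Z → Z * Θ = -Z → Z ≠ 0 →
      Module.finrank ℂ (LinearMap.range B) ≤ Module.finrank ℂ (LinearMap.range Z))
    {ι : Module.End ℂ W} {Um Up PU QU : Submodule ℂ W} (hιι : ι * ι = 1) (hιΘ : ι * Θ = Θ * ι)
    (hιs : ∀ x y, s (ι x) y = s x (ι y)) (hUm : ∀ x, x ∈ Um ↔ ι x = -x) (hUp : ∀ x, x ∈ Up ↔ ι x = x)
    (hPM : ∀ x, x ∈ LinearMap.range B ↔ ι x = -x ∧ Θ x = x)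
    (hQM : ∀ x, x ∈ Q ⊓ LinearMap.ker B ↔ ι x = -x ∧ Θ x = -x)
    (hPU : ∀ x, x ∈ PU ↔ ι x = x ∧ Θ x = x) (hQU : ∀ x, x ∈ QU ↔ ι x = x ∧ Θ x = -x)
    (hfinPU : Module.finrank ℂ PU = 5) (hfinQU : Module.finrank ℂ QU = 10)
    (hfinQM : Module.finrank ℂ ↥(Q ⊓ LinearMap.ker B) = 12)
    (hprof : ∀ X ∈ 𝔊, Θ * X = X → X * Θ = -X → X * ι = ι * X → X ≠ 0 →
      Module.finrank ℂ (Up.map X) = 4 ∧ Module.finrank ℂ (Um.map X) = 6)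
    (hjoint : ∀ q ∈ Q ⊓ LinearMap.ker B,
      (∀ X ∈ 𝔊, Θ * X = X → X * Θ = -X → X * ι = ι * X → X q = 0) → q = 0) : False := by
  classical
  obtain ⟨haddr, h0r, h0l, hnegr, hnegl, hsubr, hsubl⟩ := UnitaryTwoOdd.herm_right hadd hsymm
  obtain ⟨C, hC, hBC⟩ := hadj B hB
  have hB0 : B ≠ 0 := fun h => by rw [h, LinearMap.range_zero, finrank_bot] at hr; omega
  have hfinQU' : Module.finrank ℂ QU = Module.finrank ℂ (LinearMap.range B) := by rw [hfinQU, hr]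
  have hιιv : ∀ v, ι (ι v) = v := fun v => by rw [← Module.End.mul_apply, hιι, Module.End.one_apply]
  have hsum : ∀ X ∈ 𝔊, Θ * X = X → X * Θ = -X → X * ι = ι * X → X ≠ 0 →
      Module.finrank ℂ (Up.map X) + Module.finrank ℂ (Um.map X) = Module.finrank ℂ (LinearMap.range B) := by
    intro X hX hΘX hXΘ hXc hX0
    obtain ⟨h4, h6⟩ := hprof X hX hΘX hXΘ hXc hX0
    rw [h4, h6, hr]
  have hij : ∀ X ∈ 𝔊, Θ * X = X → X * Θ = -X → X * ι = ι * X → X ≠ 0 →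
      Module.finrank ℂ (Up.map X) < Module.finrank ℂ (Um.map X) := by
    intro X hX hΘX hXΘ hXc hX0
    obtain ⟨h4, h6⟩ := hprof X hX hΘX hXΘ hXc hX0
    rw [h4, h6]; norm_num
  -- the subspace `𝔷` of raising elements of `𝔊` commuting with `ι`
  set Zs : Submodule ℂ (Module.End ℂ W) :=
    { carrier := {X | X ∈ 𝔊 ∧ Θ * X = X ∧ X * Θ = -X ∧ X * ι = ι * X}
      zero_mem' := ⟨Submodule.zero_mem _, by rw [mul_zero], by rw [zero_mul, neg_zero], by rw [zero_mul, mul_zero]⟩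
      add_mem' := fun {X Y} hX hY => ⟨Submodule.add_mem _ hX.1 hY.1, by rw [mul_add, hX.2.1, hY.2.1],
        by rw [add_mul, hX.2.2.1, hY.2.2.1, neg_add], by rw [add_mul, mul_add, hX.2.2.2, hY.2.2.2]⟩
      smul_mem' := fun c {X} hX => ⟨Submodule.smul_mem _ c hX.1, by rw [mul_smul_comm, hX.2.1],
        by rw [smul_mul_assoc, hX.2.2.1, smul_neg], by rw [smul_mul_assoc, mul_smul_comm, hX.2.2.2]⟩ }
    with hZsdef
  have hmemZs : ∀ X, X ∈ Zs ↔ X ∈ 𝔊 ∧ Θ * X = X ∧ X * Θ = -X ∧ X * ι = ι * X := fun X => Iff.rfl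
  -- the slot maps `Y ↦ Y X† B + B X† Y`
  let slot : Module.End ℂ W → (Module.End ℂ W →ₗ[ℂ] Module.End ℂ W) := fun Xa =>
    LinearMap.mulRight ℂ (Xa * B) + LinearMap.mulLeft ℂ (B * Xa)
  have hslot : ∀ Xa Y : Module.End ℂ W, slot Xa Y = Y * Xa * B + B * Xa * Y := fun Xa Y => by
    simp only [slot, LinearMap.add_apply, LinearMap.mulRight_apply, LinearMap.mulLeft_apply, mul_assoc]
  -- wrappers of the packages
  have hmem : ∀ X Xa : Module.End ℂ W, X ∈ Zs → X ≠ 0 → Xa ∈ 𝔊 → (∀ x y, s (X x) y = s x (Xa y)) →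
      ∃ μ : ℂ, μ ≠ 0 ∧ starRingEnd ℂ μ = μ ∧ X * Xa * B + B * Xa * X = μ • B ∧ X * Xa * X = μ • X ∧
        (∀ p ∈ Up.map X, X (Xa p) = μ • p) ∧ (∀ p ∈ Um.map X, X (Xa p) = μ • p) ∧
        (∀ p ∈ Um.map X, ∃ q ∈ QU, X q = 0 ∧ B q = p) := by
    intro X Xa hXZ hX0 hXa hXXa
    obtain ⟨hX, hΘX, hXΘ, hXc⟩ := (hmemZs X).1 hXZ
    exact UnitaryProfileFourSix.member hbr hΘΘ hP hQ hadd hsmul hsymm hPQ hdefP hdefQ hadj hΘB hBΘ hB0 hmin hC hBC hιι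
      hιΘ hιs hUm hUp hPM hQM hQU hfinQU' hX hΘX hXΘ hXc hX0 hXa hXXa (hsum X hX hΘX hXΘ hXc hX0)
      (hij X hX hΘX hXΘ hXc hX0)
  have hpair : ∀ X Xa Y Ya : Module.End ℂ W, ∀ μ : ℂ, X ∈ Zs → X ≠ 0 → Xa ∈ 𝔊 →
      (∀ x y, s (X x) y = s x (Xa y)) → Y ∈ Zs → Y ≠ 0 → Ya ∈ 𝔊 → (∀ x y, s (Y x) y = s x (Ya y)) →
      starRingEnd ℂ μ = μ → X * Xa * B + B * Xa * X = μ • B → X * Xa * X = μ • X →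
      Y * Xa * B + B * Xa * Y = 0 →
      X * Xa * Y + Y * Xa * X = μ • Y ∧ Ya * X * Xa + Xa * X * Ya = μ • Ya := by
    intro X Xa Y Ya μ hXZ hX0 hXa hXXa hYZ hY0 hYa hYYa hμreal hμB hXXX horth
    obtain ⟨hX, hΘX, hXΘ, hXc⟩ := (hmemZs X).1 hXZ
    obtain ⟨hY, hΘY, hYΘ, hYc⟩ := (hmemZs Y).1 hYZ
    obtain ⟨hS, hΘS, hSΘ, hSc⟩ := (hmemZs (X + Y)).1 (Zs.add_mem hXZ hYZ)
    have hS0 : X + Y ≠ 0 := by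
      intro h0
      have hYX : Y = -X := eq_neg_of_add_eq_zero_right h0
      have h1 : Y * Xa * B + B * Xa * Y = -(μ • B) := by rw [hYX, neg_mul, neg_mul, mul_neg, ← neg_add, hμB]
      rw [horth, eq_comm, neg_eq_zero, smul_eq_zero] at h1
      rcases h1 with h1 | h1
      · -- `μ = 0` contradicts `X X† X = μ X`, `X ≠ 0`? use the member package instead: `μ ≠ 0`
        obtain ⟨μ', hμ'0, -, hμ'B, -, -, -, -⟩ := hmem X Xa hXZ hX0 hXa hXXa
        rw [h1, zero_smul] at hμB
        rw [hμB, eq_comm, smul_eq_zero] at hμ'B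
        rcases hμ'B with h | h
        · exact hμ'0 h
        · exact hB0 h
      · exact hB0 h1
    exact UnitaryProfileFourSix.pair hbr hΘΘ hP hQ hadd hsmul hsymm hPQ hdefP hdefQ hadj hΘB hBΘ hB0 hmin hC hBC hιι
      hιΘ hιs hUm hUp hPM hQM hQU hfinQU' hX hΘX hXΘ hXc hXXa hY hΘY hYΘ hYc hYa hYYa (hsum Y hY hΘY hYΘ hYc hY0)
      (hij Y hY hΘY hYΘ hYc hY0) (hsum _ hS hΘS hSΘ hSc hS0) (hij _ hS hΘS hSΘ hSc hS0) hXa hμreal hμB hXXX horth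
  have hosymm : ∀ X Xa Y Ya : Module.End ℂ W, X ∈ Zs → X ≠ 0 → Xa ∈ 𝔊 → (∀ x y, s (X x) y = s x (Xa y)) →
      Y ∈ Zs → Y ≠ 0 → Ya ∈ 𝔊 → (∀ x y, s (Y x) y = s x (Ya y)) →
      Y * Xa * B + B * Xa * Y = 0 → X * Ya * B + B * Ya * X = 0 := by
    intro X Xa Y Ya hXZ hX0 hXa hXXa hYZ hY0 hYa hYYa horth
    obtain ⟨hX, hΘX, hXΘ, hXc⟩ := (hmemZs X).1 hXZ
    obtain ⟨hY, hΘY, hYΘ, hYc⟩ := (hmemZs Y).1 hYZ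
    exact UnitaryProfileFourSix.orth_symm hbr hΘΘ hP hQ hadd hsymm hPQ hdefP hdefQ hadj hΘB hBΘ hB0 hmin hC hBC hιι
      hιΘ hιs hUm hUp hPM hQM hQU hfinQU' hX hΘX hXΘ hXc hX0 hXa hXXa hY hΘY hYΘ hYc hYa hYYa
      (hsum X hX hΘX hXΘ hXc hX0) (hij X hX hΘX hXΘ hXc hX0) (hsum Y hY hΘY hYΘ hYc hY0)
      (hij Y hY hΘY hYΘ hYc hY0) horth
  -- basic geometry of the pieces
  have hBinj : ∀ a ∈ QU, B a = 0 → a = 0 := by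
    intro a ha hBa
    obtain ⟨hιa, hΘa⟩ := (hQU a).1 ha
    have hmem' : a ∈ Q ⊓ LinearMap.ker B := Submodule.mem_inf.2 ⟨(hQ a).2 hΘa, LinearMap.mem_ker.2 hBa⟩
    obtain ⟨hιa', -⟩ := (hQM a).1 hmem'
    rw [hιa] at hιa'
    have h2 : (2 : ℂ) • a = 0 := by rw [two_smul]; nth_rewrite 2 [hιa']; rw [add_neg_cancel]
    exact (smul_eq_zero.1 h2).resolve_left two_ne_zero
  have hmapUpPU : ∀ Y : Module.End ℂ W, Θ * Y = Y → Y * ι = ι * Y → Up.map Y ≤ PU := by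
    intro Y hΘY hYc
    rintro _ ⟨u, hu, rfl⟩
    exact (hPU _).2 ⟨by rw [← Module.End.mul_apply, ← hYc, Module.End.mul_apply, (hUp u).1 hu],
      by rw [← Module.End.mul_apply, hΘY]⟩
  -- THE INDUCTION over orthogonal families, on the dimension of the orthogonal complement in `𝔷`
  suffices key : ∀ (d t : ℕ) (X Xa : Fin t → Module.End ℂ W),
      (∀ a, X a ∈ Zs ∧ X a ≠ 0 ∧ Xa a ∈ 𝔊 ∧ ∀ x y, s (X a x) y = s x (Xa a y)) →
      (∀ a b, a ≠ b → X b * Xa a * B + B * Xa a * X b = 0) →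
      5 ≤ Module.finrank ℂ ↥(PU ⊓ ⨅ a, Up.map (X a)) + t →
      ((t = 0 → Module.finrank ℂ ↥(QU ⊓ ⨅ a, LinearMap.ker (X a)) ≤ 10 ∧
          12 ≤ Module.finrank ℂ ↥((Q ⊓ LinearMap.ker B) ⊓ ⨅ a, LinearMap.ker (X a))) ∧
        (t = 1 → Module.finrank ℂ ↥(QU ⊓ ⨅ a, LinearMap.ker (X a)) ≤ 6 ∧
          6 ≤ Module.finrank ℂ ↥((Q ⊓ LinearMap.ker B) ⊓ ⨅ a, LinearMap.ker (X a))) ∧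
        (t = 2 → Module.finrank ℂ ↥(QU ⊓ ⨅ a, LinearMap.ker (X a)) ≤ 3 ∧
          3 ≤ Module.finrank ℂ ↥((Q ⊓ LinearMap.ker B) ⊓ ⨅ a, LinearMap.ker (X a))) ∧
        (t = 3 → Module.finrank ℂ ↥(QU ⊓ ⨅ a, LinearMap.ker (X a)) ≤ 1 ∧
          2 ≤ Module.finrank ℂ ↥((Q ⊓ LinearMap.ker B) ⊓ ⨅ a, LinearMap.ker (X a))) ∧
        (4 ≤ t → Module.finrank ℂ ↥(QU ⊓ ⨅ a, LinearMap.ker (X a)) = 0 ∧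
          2 ≤ Module.finrank ℂ ↥((Q ⊓ LinearMap.ker B) ⊓ ⨅ a, LinearMap.ker (X a)))) →
      Module.finrank ℂ ↥(Zs ⊓ ⨅ a, LinearMap.ker (slot (Xa a))) = d → False by
    refine key _ 0 Fin.elim0 Fin.elim0 (fun a => a.elim0) (fun a => a.elim0) ?_ ?_ rfl
    · rw [iInf_of_empty, inf_top_eq, hfinPU]
    · rw [iInf_of_empty, inf_top_eq, inf_top_eq, hfinQU, hfinQM]
      omega
  intro d
  refine Nat.strong_induction_on d ?_
  intro d ih t X Xa hfam horth hH hinv hd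
  set N : Submodule ℂ W := QU ⊓ ⨅ a, LinearMap.ker (X a) with hN
  set K : Submodule ℂ W := (Q ⊓ LinearMap.ker B) ⊓ ⨅ a, LinearMap.ker (X a) with hK
  set Hc : Submodule ℂ W := PU ⊓ ⨅ a, Up.map (X a) with hHc
  set Zo : Submodule ℂ (Module.End ℂ W) := Zs ⊓ ⨅ a, LinearMap.ker (slot (Xa a)) with hZo
  have hm2 : 2 ≤ Module.finrank ℂ K := by
    obtain ⟨h0, h1, h2, h3, h4⟩ := hinv
    by_cases ht0 : t = 0
    · exact le_trans (by norm_num) (h0 ht0).2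
    by_cases ht1 : t = 1
    · exact le_trans (by norm_num) (h1 ht1).2
    by_cases ht2 : t = 2
    · exact le_trans (by norm_num) (h2 ht2).2
    by_cases ht3 : t = 3
    · exact (h3 ht3).2
    exact (h4 (by omega)).2
  -- member constants of the family
  have hμex : ∀ a, ∃ μ : ℂ, μ ≠ 0 ∧ starRingEnd ℂ μ = μ ∧ X a * Xa a * B + B * Xa a * X a = μ • B ∧
      X a * Xa a * X a = μ • X a ∧ (∀ p ∈ Up.map (X a), X a (Xa a p) = μ • p) ∧
      (∀ p ∈ Um.map (X a), X a (Xa a p) = μ • p) ∧ (∀ p ∈ Um.map (X a), ∃ q ∈ QU, X a q = 0 ∧ B q = p) :=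
    fun a => hmem (X a) (Xa a) (hfam a).1 (hfam a).2.1 (hfam a).2.2.1 (hfam a).2.2.2
  choose μ hμ0 hμreal hμB hXXX hpX hmX hBX using hμex
  by_cases hterm : ∀ Y ∈ Zo, Y = 0
  · -- TERMINAL CASE: `𝔷 = span (X a)`, so `𝔷` kills `K`, so `K = 0` — against `dim K ≥ 2`
    have hKbot : K = ⊥ := by
      refine (Submodule.eq_bot_iff _).2 fun k hk => ?_
      obtain ⟨hkQ, hkX⟩ := Submodule.mem_inf.1 hk
      refine hjoint k hkQ fun Y hY hΘY hYΘ hYc => ?_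
      have hYZ : Y ∈ Zs := ⟨hY, hΘY, hYΘ, hYc⟩
      obtain ⟨Ya, hYa, hYYa⟩ := hadj Y hY
      have hcex : ∀ a, ∃ c : ℂ, Y * Xa a * B + B * Xa a * Y = c • B := by
        intro a
        obtain ⟨hXa1, hΘXa, hXaΘ, hXac⟩ := (hmemZs (X a)).1 (hfam a).1
        exact UnitaryLeviSetup.slot_identity hbr hΘΘ hP hQ hadd hsymm hPQ hdefP hdefQ hadj hΘB hBΘ hB0 hmin hC hBC hιι
          hιΘ hιs hPM hQM hQU hfinQU' hXa1 hΘXa hXaΘ hXac (hfam a).2.2.2 hΘY hYΘ hYc hYa hYYa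
      choose c hc using hcex
      set Y' : Module.End ℂ W := Y - ∑ a, (c a / μ a) • X a with hY'
      have hY'Z : Y' ∈ Zs :=
        Zs.sub_mem hYZ (Zs.sum_mem fun a _ => Zs.smul_mem _ (hfam a).1)
      have hY'orth : ∀ b, slot (Xa b) Y' = 0 := by
        intro b
        rw [hY', map_sub, map_sum, hslot, hc b, Finset.sum_eq_single b, map_smul, hslot, hμB b, smul_smul,
          div_mul_cancel₀ _ (hμ0 b), sub_self]
        · intro a _ hab
          rw [map_smul, hslot, horth b a (Ne.symm hab), smul_zero]
        · intro h; exact absurd (Finset.mem_univ b) h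
      have hY'0 : Y' = 0 := hterm Y' (Submodule.mem_inf.2 ⟨hY'Z, (Submodule.mem_iInf _).2 fun b =>
        LinearMap.mem_ker.2 (hY'orth b)⟩)
      have hYsum : Y = ∑ a, (c a / μ a) • X a := sub_eq_zero.1 (by rw [← hY']; exact hY'0)
      rw [hYsum, LinearMap.sum_apply]
      refine Finset.sum_eq_zero fun a _ => ?_
      rw [LinearMap.smul_apply, LinearMap.mem_ker.1 ((Submodule.mem_iInf _).1 hkX a), smul_zero]
    rw [hKbot, finrank_bot] at hm2
    omega
  · -- INDUCTIVE CASE: extend the family by a non-zero `Y ∈ 𝔷` orthogonal to it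
    push Not at hterm
    obtain ⟨Y, hYZo, hY0⟩ := hterm
    obtain ⟨hYZ, hYorth⟩ := Submodule.mem_inf.1 hYZo
    have hYo : ∀ a, Y * Xa a * B + B * Xa a * Y = 0 := fun a => by
      have h := (Submodule.mem_iInf _).1 hYorth a
      rw [LinearMap.mem_ker, hslot] at h
      exact h
    obtain ⟨hY, hΘY, hYΘ, hYc⟩ := (hmemZs Y).1 hYZ
    obtain ⟨Ya, hYa, hYYa⟩ := hadj Y hY
    obtain ⟨hΘYa, hYaΘ, hYac, hYaY⟩ :=
      UnitaryLeviSetup.adj_raise hΘΘ hP hQ hadd hsymm hPQ hdefP hdefQ hιs hΘY hYΘ hYc hYYa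
    obtain ⟨μY, hμY0, hμYreal, hμYB, hYYY, hpY, hmY, hBY⟩ := hmem Y Ya hYZ hY0 hYa hYYa
    have hY46 := hprof Y hY hΘY hYΘ hYc hY0
    -- (II) and (II)† for the pairs `(X a, Y)`
    have hII : ∀ a, X a * Xa a * Y + Y * Xa a * X a = μ a • Y ∧ Ya * X a * Xa a + Xa a * X a * Ya = μ a • Ya :=
      fun a => hpair (X a) (Xa a) Y Ya (μ a) (hfam a).1 (hfam a).2.1 (hfam a).2.2.1 (hfam a).2.2.2 hYZ hY0 hYa hYYa
        (hμreal a) (hμB a) (hXXX a) (hYo a)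
    -- the new family
    set X' : Fin (t + 1) → Module.End ℂ W := Fin.snoc X Y with hX'
    set Xa' : Fin (t + 1) → Module.End ℂ W := Fin.snoc Xa Ya with hXa'
    have hfam' : ∀ a, X' a ∈ Zs ∧ X' a ≠ 0 ∧ Xa' a ∈ 𝔊 ∧ ∀ x y, s (X' a x) y = s x (Xa' a y) := by
      intro a
      refine Fin.lastCases ?_ (fun a => ?_) a
      · simp only [hX', hXa', Fin.snoc_last]; exact ⟨hYZ, hY0, hYa, hYYa⟩
      · simp only [hX', hXa', Fin.snoc_castSucc]; exact hfam a
    have horth' : ∀ a b, a ≠ b → X' b * Xa' a * B + B * Xa' a * X' b = 0 := by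
      intro a b hab
      induction a using Fin.lastCases with
      | last =>
        induction b using Fin.lastCases with
        | last => exact absurd rfl hab
        | cast b =>
          simp only [hX', hXa', Fin.snoc_last, Fin.snoc_castSucc]
          exact hosymm (X b) (Xa b) Y Ya (hfam b).1 (hfam b).2.1 (hfam b).2.2.1 (hfam b).2.2.2 hYZ hY0 hYa hYYa (hYo b)
      | cast a =>
        induction b using Fin.lastCases with
        | last => simp only [hX', hXa', Fin.snoc_last, Fin.snoc_castSucc]; exact hYo a
        | cast b =>
          simp only [hX', hXa', Fin.snoc_castSucc]
          exact horth a b fun h => hab (by rw [h])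
    -- the new pieces
    have hN' : (QU ⊓ ⨅ a, LinearMap.ker (X' a)) = N ⊓ LinearMap.ker Y := by
      rw [hX', UnitaryProfileFourSix.iInf_comp_snoc (fun Z : Module.End ℂ W => LinearMap.ker Z), hN, inf_assoc]
    have hK' : ((Q ⊓ LinearMap.ker B) ⊓ ⨅ a, LinearMap.ker (X' a)) = K ⊓ LinearMap.ker Y := by
      rw [hX', UnitaryProfileFourSix.iInf_comp_snoc (fun Z : Module.End ℂ W => LinearMap.ker Z), hK]
      simp only [inf_assoc]
    have hHc' : (PU ⊓ ⨅ a, Up.map (X' a)) = Hc ⊓ Up.map Y := by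
      rw [hX', UnitaryProfileFourSix.iInf_comp_snoc (fun Z : Module.End ℂ W => Up.map Z), hHc, inf_assoc]
    have hZo' : (Zs ⊓ ⨅ a, LinearMap.ker (slot (Xa' a))) = Zo ⊓ LinearMap.ker (slot Ya) := by
      rw [hXa', UnitaryProfileFourSix.iInf_comp_snoc (fun Z : Module.End ℂ W => LinearMap.ker (slot Z)), hZo, inf_assoc]
    -- (R1) rank–nullity for `Y` on `N` and on `K`
    have hR1 := UnitaryProfileFourSix.finrank_inf_ker_add_finrank_map N Y
    have hR1K := UnitaryProfileFourSix.finrank_inf_ker_add_finrank_map K Y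
    -- (R2) `Hc ∩ Y(U⁺) ⊆ Y(N)`
    have hR2 : Hc ⊓ Up.map Y ≤ N.map Y := by
      intro p hp
      obtain ⟨hpHc, hpUY⟩ := Submodule.mem_inf.1 hp
      obtain ⟨hpPU, hpXcap⟩ := Submodule.mem_inf.1 hpHc
      obtain ⟨hιp, -⟩ := (hPU p).1 hpPU
      refine ⟨μY⁻¹ • Ya p, Submodule.mem_inf.2 ⟨Submodule.smul_mem _ _ ((hQU _).2 ⟨?_, ?_⟩),
        (Submodule.mem_iInf _).2 fun a => LinearMap.mem_ker.2 ?_⟩, ?_⟩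
      · rw [← Module.End.mul_apply, ← hYac, Module.End.mul_apply, hιp]
      · rw [← Module.End.mul_apply, hΘYa, LinearMap.neg_apply]
      · -- `X a (Y† p) = 0` from (II)† and `X a X a† p = μ a p`
        rw [map_smul]
        have hpa : p ∈ Up.map (X a) := (Submodule.mem_iInf _).1 hpXcap a
        have h := congrArg (fun T : Module.End ℂ W => T p) (hII a).2
        simp only [LinearMap.add_apply, Module.End.mul_apply, LinearMap.smul_apply] at h
        rw [hpX a p hpa, map_smul, add_eq_left] at h
        obtain ⟨-, hΘXa1, -, -⟩ := (hmemZs (X a)).1 (hfam a).1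
        have hmemP : X a (Ya p) ∈ P := (hP _).2 (by rw [← Module.End.mul_apply, hΘXa1])
        have h0 : X a (Ya p) = 0 := hdefP _ hmemP (by rw [(hfam a).2.2.2, h, h0r])
        rw [h0, smul_zero]
      · rw [map_smul, hpY p hpUY, smul_smul, inv_mul_cancel₀ hμY0, one_smul]
    -- (R3) `dim (Hc ∩ Y(U⁺)) + 1 ≥ dim Hc` (`Y(U⁺)` is a hyperplane of `P ∩ U⁺`)
    have hR3 : Module.finrank ℂ Hc ≤ Module.finrank ℂ ↥(Hc ⊓ Up.map Y) + 1 := by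
      have h1 := Submodule.finrank_sup_add_finrank_inf_eq Hc (Up.map Y)
      have h2 : Module.finrank ℂ ↥(Hc ⊔ Up.map Y) ≤ 5 := by
        rw [← hfinPU]; exact Submodule.finrank_mono (sup_le inf_le_left (hmapUpPU Y hΘY hYc))
      rw [hY46.1] at h1
      omega
    -- (R4) `Y(K) ⊆ B(N ∩ ker Y)`
    have hR4 : Module.finrank ℂ (K.map Y) ≤ Module.finrank ℂ ↥(N ⊓ LinearMap.ker Y) := by
      have hle : K.map Y ≤ (N ⊓ LinearMap.ker Y).map B := by
        rintro _ ⟨k, hk, rfl⟩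
        obtain ⟨hkQ, hkX⟩ := Submodule.mem_inf.1 hk
        obtain ⟨hιk, -⟩ := (hQM k).1 hkQ
        have hkUm : k ∈ Um := (hUm k).2 hιk
        obtain ⟨q, hqQU, hYq, hBq⟩ := hBY (Y k) (Submodule.mem_map_of_mem hkUm)
        refine ⟨q, Submodule.mem_inf.2 ⟨Submodule.mem_inf.2 ⟨hqQU, (Submodule.mem_iInf _).2 fun a =>
          LinearMap.mem_ker.2 ?_⟩, LinearMap.mem_ker.2 hYq⟩, hBq⟩
        -- `Y k ∈ X a(U⁻)` by (II), so `Y k = B q_a` with `X a q_a = 0`, and `q_a = q`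
        have hXak : X a k = 0 := LinearMap.mem_ker.1 ((Submodule.mem_iInf _).1 hkX a)
        have h := congrArg (fun T : Module.End ℂ W => T k) (hII a).1
        simp only [LinearMap.add_apply, Module.End.mul_apply, LinearMap.smul_apply, hXak, map_zero, add_zero] at h
        have hYkUm : Y k ∈ Um :=
          (hUm _).2 (by rw [← Module.End.mul_apply, ← hYc, Module.End.mul_apply, hιk, map_neg])
        obtain ⟨hXa1, hΘXa1, hXaΘ1, hXac1⟩ := (hmemZs (X a)).1 (hfam a).1
        obtain ⟨-, -, hXaac, -⟩ :=
          UnitaryLeviSetup.adj_raise hΘΘ hP hQ hadd hsymm hPQ hdefP hdefQ hιs hΘXa1 hXaΘ1 hXac1 (hfam a).2.2.2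
        have hmemUm : Xa a (Y k) ∈ Um :=
          (hUm _).2 (by rw [← Module.End.mul_apply, ← hXaac, Module.End.mul_apply, (hUm _).1 hYkUm, map_neg])
        have hYk : Y k ∈ Um.map (X a) := by
          have e : Y k = (μ a)⁻¹ • X a (Xa a (Y k)) := by rw [h, smul_smul, inv_mul_cancel₀ (hμ0 a), one_smul]
          rw [e]; exact Submodule.smul_mem _ _ (Submodule.mem_map_of_mem hmemUm)
        obtain ⟨qa, hqaQU, hXqa, hBqa⟩ := hBX a (Y k) hYk
        have hqq : qa = q := by
          have h0 : B (qa - q) = 0 := by rw [map_sub, hBqa, hBq, sub_self]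
          exact sub_eq_zero.1 (hBinj _ (Submodule.sub_mem _ hqaQU hqQU) h0)
        rw [← hqq]; exact hXqa
      exact (Submodule.finrank_mono hle).trans (Submodule.finrank_map_le _ _)
    -- (R5) the orthogonal complement shrinks strictly
    have hlt : Module.finrank ℂ ↥(Zo ⊓ LinearMap.ker (slot Ya)) < d := by
      rw [← hd]
      refine Submodule.finrank_lt_finrank_of_lt (lt_of_le_of_ne inf_le_left fun heq => ?_)
      have hYmem : Y ∈ Zo ⊓ LinearMap.ker (slot Ya) := by rw [heq]; exact hYZo
      have h := (Submodule.mem_inf.1 hYmem).2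
      rw [LinearMap.mem_ker, hslot, hμYB] at h
      rcases smul_eq_zero.1 h with h | h
      · exact hμY0 h
      · exact hB0 h
    -- apply the induction hypothesis to the extended family
    have h2' := Submodule.finrank_mono hR2
    have hd' : Module.finrank ℂ ↥(Zs ⊓ ⨅ a, LinearMap.ker (slot (Xa' a))) =
        Module.finrank ℂ ↥(Zo ⊓ LinearMap.ker (slot Ya)) := by
      rw [hZo']
    refine ih _ hlt (t + 1) X' Xa' hfam' horth' ?_ ?_ hd'
    · rw [hHc']; omega
    · rw [hN', hK']
      omega

end HodgeStructure

end Literature.AlgebraicGeometry.Motives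

end
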